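import Literature.NumberTheory.Sieve.ParityWave0MaynardProofs
import Literature.NumberTheory.Sieve.VaughanMeanValue
import Literature.NumberTheory.Sieve.MaynardSieveLemma62
import Literature.NumberTheory.Sieve.MaynardSieveLemma52
import Literature.NumberTheory.Sieve.MaynardSieveLemma63Sum
import Literature.NumberTheory.Sieve.MaynardSieveYm
import Literature.NumberTheory.Sieve.GoldstonGrahamPintzYildirimProofs
import Literature.NumberTheory.Sieve.GoldstonGrahamPintzYildirimLemma3
import Literature.NumberTheory.LFunctions.SiegelWalfisz
import HarnessLib

/-!
# Maynard 2015, Theorem 1.3 (`liminf (p_{n+1} − p_n) ≤ 600`) proved: `frequently_nth_prime_succ_le_add_maynard_holds`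

Topic `Literature/NumberTheory/Sieve`; sibling proof file (theorems only, no new definitions) of
`ParityWave0.lean` for the Wave-0 named fact `Literature.NumberTheory.Sieve.frequently_nth_prime_succ_le_add_maynard`
(parity.S13): J. Maynard, *Small gaps between primes*, Ann. of Math. (2) 181 (2015), 383–413,
**Theorem 1.3** (p. 3 of the arXiv text): `liminf_n (p_{n+1} − p_n) ≤ 600` — vendored as
`∃ᶠ n, p_{n+1} ≤ p_n + 600` (equivalent for integer gaps).

The printed proof (§4, p. 8) — `k = 105`, `M_105 > 4` (Proposition 4.3), the Bombieri–Vinogradov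
theorem (`θ = 1/2 − ε`), Proposition 4.2 (from Proposition 4.1 = Lemmas 6.2, 6.3) and Engelsma's
admissible 105-tuple of diameter 600 — is assembled from the tree as follows:

* `ParityWave0MaynardProofs.lean`:
  `frequently_nth_prime_succ_le_add_maynard_of_bombieri_vinogradov_of_sieveAsymptotics` — the
  target from `bombieri_vinogradov` (parity.S27) and the two halves of Proposition 4.1
  (`maynard_S1_asymptotic`, `maynard_S2_asymptotic`), using `M_105 > 4` (`MaynardK105.lean`), the
  admissible tuple `maynardTuple ⊆ [0, 600]` and Prop. 4.2 ⇐ Prop. 4.1 for `C¹ · 1_{R_k}` test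
  functions (`MaynardSieve.lean`);
* `VaughanMeanValue.lean`: `bombieri_vinogradov_of_siegelWalfisz` (Vaughan's identity, the large
  sieve), with `SiegelWalfisz.lean`: `siegel_walfisz_holds` (parity.S28; Montgomery–Vaughan
  Cor. 11.19);
* `MaynardSieveLemma62.lean`: `maynard_S1_asymptotic_holds` (Lemmas 5.1, 6.2);
* the `S₂` half (Lemma 6.3): `maynard_S2_asymptotic_of` (`MaynardSieveS2.lean`) applied to Lemma 5.2
  (`maynard_lemma52_holds`, `MaynardSieveLemma52.lean`), the evaluation (6.10) of `y^{(m)}`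
  (`maynard_lemma63_ym_of_GGPY`, `MaynardSieveYm.lean`, fed with Lemma 6.1 = Goldston–Graham–Pintz–
  Yıldırım 2009, Lemma 4: `GGPY.moebiusSqGSumWeighted_asymptotic_of GGPY.moebiusSqGSum_asymptotic_holds`,
  `GoldstonGrahamPintzYildirimProofs.lean`/`…Lemma3.lean`) and (6.11)–(6.14)
  (`maynard_lemma63_sum_holds`, `MaynardSieveLemma63Sum.lean`). (The same term is recorded as
  `Literature.NumberTheory.Sieve.maynard_S2_asymptotic_holds` in the Theorem-1.1 leaf `MaynardTaoTheoremProofs.lean`, which is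
  not imported here.)

All axioms standard; no named fact remains on this path.

## References

* J. Maynard, *Small gaps between primes*, Ann. of Math. (2) 181 (2015), 383–413,
  doi:10.4007/annals.2015.181.1.7 = arXiv:1311.4600, Theorem 1.3 and its proof in §4 (p. 8).
  [MaynardAnnals2015]
-/

namespace Literature.NumberTheory.Sieve

/-- **Maynard 2015, Theorem 1.3, PROVED**: `liminf_n (p_{n+1} − p_n) ≤ 600`, i.e. the Wave-0 named
fact `frequently_nth_prime_succ_le_add_maynard` (`∃ᶠ n, p_{n+1} ≤ p_n + 600`) DISCHARGED along the
printed proof (§4, p. 8): Bombieri–Vinogradov (via Siegel–Walfisz), Proposition 4.1 (Lemma 6.2: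
`maynard_S1_asymptotic_holds`; Lemma 6.3: Lemma 5.2 + (6.10) from Lemma 6.1 + (6.11)–(6.14)),
`M_105 > 4` and the admissible 105-tuple of diameter 600 (inside
`frequently_nth_prime_succ_le_add_maynard_of_bombieri_vinogradov_of_sieveAsymptotics`).
[cite: MaynardAnnals2015, Theorem 1.3 and its proof in §4] -/
theorem frequently_nth_prime_succ_le_add_maynard_holds : frequently_nth_prime_succ_le_add_maynard :=
  frequently_nth_prime_succ_le_add_maynard_of_bombieri_vinogradov_of_sieveAsymptotics
    (bombieri_vinogradov_of_siegelWalfisz LFunctions.siegel_walfisz_holds) maynard_S1_asymptotic_holds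
    (maynard_S2_asymptotic_of maynard_lemma52_holds
      (maynard_lemma63_ym_of_GGPY
        (GGPY.moebiusSqGSumWeighted_asymptotic_of GGPY.moebiusSqGSum_asymptotic_holds))
      maynard_lemma63_sum_holds)

end Literature.NumberTheory.Sieve
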